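/-
Copyright (c) 2026 the pub-hodgecm-mathlib formalisation cell (harness21).  Prover seat hodgecm-mathlib-LH4-p14 (g6), 2026-09-04 — STAGE-1b (β-BAL) road, dealer∕pen LH4-plan (g13)
WORD #86 ∕ #95 (x): brick (β-BAL-3) = B3, FILE 3 — the `j = 0` (conic) count, first half (LH4-p11 (g8) (Q3): «j = 0 IS NEEDED — the isosceles two-slot case»).
-/
import Summits.HodgeConjecture.HodgeConjecture.Theorems.F0P3cDyRamBinaryNormFormFixedSums   -- ★ p860400 FILE 1 (this seat): `map_binaryNormForm`; brings the ★ ω-conductor toolkit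
import HarnessLib

/-!
# Crux `H413`, line LH4 «(D-RAM) FOUR-FRAME», STAGE-1b (β-BAL) — B3 «THE BINARY NORM-FORM CHARACTER COUNT», FILE 3: the `j = 0` (CONIC) count — uniform fibres within a norm
# class at any depth, and the ANISOTROPIC VANISHING `Σ_{r} ω(C₀ + C₁N r) = 0` when both `C₀∕C₁` and `−C₀∕C₁` are non-norms

Cell `hodgecm-mathlib` (D-0151), FLOOR 0, crux item H413 = `stmt-HodgeConjecture-24833`, route `HCCMUnconditional`; squad LH4; lane `--supports stmt-HodgeConjecture-24833 --as helper`.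
THEOREMS ONLY (no `def`, no instance, no `sorry`, default heartbeats); pure local arithmetic; COUNT-NEUTRAL.  Carrier as in FILES 1–2 (LH4-p11 (g8) (Q2)).

`j = 0` is the regime where the binary norm-form value `C₀ + C₁N r = C₁·(N r − c)`, `c := −C₀∕C₁`, can approach `0`: its norm class is read at depth `|N r − c|·|ϖ|^{2d−1}`, i.e.
ABOVE the conductor, where the norm residues are no longer equidistributed over all unit classes (FILE 2 §1 needs `e ≤ d − 1`).  THIS FILE:
* §1 (U′) `card_filter_norm_near_eq_of_isNorm` — WITHIN ONE NORM CLASS the fibres `{r : |N r − a| ≤ |ϖ|^{2e}}` are still uniform at ANY depth `e` (`2e ≤ s`): the constant-multiplier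
  transport of FILE 2 §1 with an EXACT multiplier (`a′∕a = N z₀`).
* §2 (D⁻) `sum_units_normSign_binaryNormForm_zero_eq_zero_of_not_isNorm` — THE ANISOTROPIC VANISHING: if `c = −C₀∕C₁` is NOT a norm (so `|N r − c| ≥ |ϖ|^{2d−2}` for every
  unit `r`: the value never reaches the conductor) and `−c = C₀∕C₁` is NOT a norm either, then for `s + 2 ≥ 4d − 1`... precisely `4 * d ≤ s + 3`:
  **`Σ_{r ∈ R, |r| = 1} ω(C₀ + C₁N r) = 0`** — the involution `r ↦ rep(c·(σ r)⁻¹)` realises `n ↦ c²∕n` on the norms, and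
  `C₀ + C₁c²∕n = (−c∕n)·(C₀ + C₁n)` flips `ω` exactly when `ω(−c) = −1` (`ω(n) = 1`).
LEFT (SIG (D), next hand): the case `ω(C₀∕C₁) = +1` (no flip) and the ISOTROPIC case `ω(−C₀∕C₁) = +1` (the value meets every depth; closed form in the three signs per LH4-p11 (g8)).
HONEST LABEL.  Count-neutral; (β-BAL), (β), T₊ stay OPEN; HC_CM is proved only modulo the 7 printed citations (2 remaining named inputs: hLiu418 = `stmt-HodgeConjecture-24832`,
h413 = `stmt-HodgeConjecture-24833`) until rung 0 closes.

## References
* [Serre1979] J.-P. Serre, *Local Fields*, GTM 67 (1979) — Ch. V §3 Prop. 5, Cor. 2–3, Ch. XV §2.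
* [NeukirchANT1999] J. Neukirch, *Algebraic Number Theory* (1999) — Ch. V (1.3).
-/

set_option autoImplicit false

noncomputable section

namespace Summit.HodgeConjecture.HodgeConjecture.Cruxes.H413.F0P3cDyRamBinaryNormFormConicCount

open WithZero
open scoped Valued
open Literature.NumberTheory.Automorphic.UnitaryThreeFourFrame
open Literature.NumberTheory.LocalFields.WildQuadraticDatum
open Summit.HodgeConjecture.HodgeConjecture.Cruxes.H413.F0P3cDyRamBinaryNormFormFixedSums

variable {K : Type} [Field K] [Valued K ℤᵐ⁰] {σ : K →+* K} {ϖ : K} {d t : ℕ}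

/-! ## §1  (U′) Uniform fibres over the NORM classes at ANY depth (groundwork for the `j = 0` conic count) -/

/-- **(U′) UNIFORM FIBRES WITHIN A NORM CLASS, ANY DEPTH.**  `R` a complete irredundant residue system modulo `ϖ^s`, `a, a′` fixed units IN THE SAME NORM CLASS (`a′∕a = N z₀`
exactly — e.g. `ω(a′∕a) = 1`), `1 ≤ e`, `2e ≤ s` (no bound `e ≤ d − 1` here): the fibres `{r ∈ R : |r| = 1, |N r − a| ≤ |ϖ|^{2e}}` and `{… a′ …}` have the same cardinality — the
constant-multiplier transport of ★ FILE 2 §1 with an EXACT `z₀`.  Above the conductor (`e ≥ d`) the fibres over different norm classes differ (one of them is empty), so this is the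
right uniformity for the deep classes of the `j = 0` count. [cite: Serre1979, Ch. V §3 Cor. 3] -/
theorem card_filter_norm_near_eq_of_isNorm (hD : IsRamifiedQuadraticDatum σ ϖ d t)
    {e s : ℕ} (he : 1 ≤ e) (hes : 2 * e ≤ s)
    (R : Finset K) (hR₁ : ∀ r ∈ R, Valued.v r ≤ 1) (hR₂ : ∀ x : K, Valued.v x ≤ 1 → ∃ r ∈ R, Valued.v (x - r) ≤ Valued.v ϖ ^ s)
    (hR₃ : ∀ r ∈ R, ∀ r' ∈ R, Valued.v (r - r') ≤ Valued.v ϖ ^ s → r = r')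
    {a a' : K} (ha : Valued.v a = 1) (ha' : Valued.v a' = 1) (hz₀ : ∃ z₀ : K, z₀ * σ z₀ = a' / a) :
    (R.filter fun r => Valued.v r = 1 ∧ Valued.v (r * σ r - a) ≤ Valued.v ϖ ^ (2 * e)).card =
      (R.filter fun r => Valued.v r = 1 ∧ Valued.v (r * σ r - a') ≤ Valued.v ϖ ^ (2 * e)).card := by
  classical
  obtain ⟨hσ, hvσ, hϖ, -, -, -, -⟩ := id hD
  have hϖ1 : Valued.v ϖ ≤ 1 := by rw [hϖ, ← exp_zero]; exact exp_le_exp.2 (by norm_num)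
  -- one-sided transport with an exact multiplier, in both directions
  have key : ∀ {b b' : K}, Valued.v b = 1 → Valued.v b' = 1 → (∃ z : K, z * σ z = b' / b) →
      (R.filter fun r => Valued.v r = 1 ∧ Valued.v (r * σ r - b) ≤ Valued.v ϖ ^ (2 * e)).card ≤
        (R.filter fun r => Valued.v r = 1 ∧ Valued.v (r * σ r - b') ≤ Valued.v ϖ ^ (2 * e)).card := by
    intro b b' hb hb' hz
    obtain ⟨z, hz⟩ := hz
    have hb0 : b ≠ 0 := fun h => by rw [h, map_zero] at hb; exact zero_ne_one hb
    have hNz : Valued.v (z * σ z) = 1 := by rw [hz, map_div₀, hb, hb', div_one]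
    have hz1 : Valued.v z = 1 := by
      have h2 : Valued.v z * Valued.v z = 1 := by rw [map_mul, hvσ] at hNz; exact hNz
      rcases le_or_gt (Valued.v z) 1 with h | h
      · by_contra hne
        have hlt : Valued.v z < 1 := lt_of_le_of_ne h hne
        have : Valued.v z * Valued.v z < 1 := mul_lt_one_of_lt_of_le hlt h
        exact absurd h2 this.ne
      · have : 1 < Valued.v z * Valued.v z := one_lt_mul_of_lt_of_le' h h.le
        exact absurd h2 this.ne'
    have hrep : ∀ r ∈ R, ∃ r' ∈ R, Valued.v (r * z - r') ≤ Valued.v ϖ ^ s := fun r hr =>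
      hR₂ (r * z) (by rw [map_mul, hz1, mul_one]; exact hR₁ r hr)
    choose! φ hφR hφ using hrep
    refine Finset.card_le_card_of_injOn φ (fun r hr => ?_) (fun r₁ hr₁ r₂ hr₂ h => ?_)
    · rw [Finset.mem_coe, Finset.mem_filter] at hr ⊢
      obtain ⟨hrR, hr1, hra⟩ := hr
      refine ⟨hφR r hrR, ?_, ?_⟩
      · have hrz : Valued.v (r * z) = 1 := by rw [map_mul, hr1, hz1, one_mul]
        have hlt : Valued.v (r * z - φ r) < Valued.v (r * z) := by
          rw [hrz]
          refine lt_of_le_of_lt (hφ r hrR) ?_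
          rw [hϖ, ← exp_nsmul, nsmul_eq_mul, mul_neg, mul_one, ← exp_zero]
          exact exp_lt_exp.2 (by omega)
        have hlt' : Valued.v (φ r - r * z) < Valued.v (r * z) := by rwa [← Valuation.map_neg, neg_sub]
        have e1 : φ r = r * z + (φ r - r * z) := by ring
        rw [e1, Valuation.map_add_eq_of_lt_left _ hlt', hrz]
      · set δ := φ r - r * z with hδ
        have hvδ : Valued.v δ ≤ Valued.v ϖ ^ s := by rw [hδ, ← Valuation.map_neg, neg_sub]; exact hφ r hrR
        have hvδ' : Valued.v δ ≤ Valued.v ϖ ^ (2 * e) := hvδ.trans (pow_le_pow_right_of_le_one' hϖ1 hes)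
        have hbz : b * (z * σ z) = b' := by rw [hz, mul_div_cancel₀ _ hb0]
        have hN : φ r * σ (φ r) - b' = (r * σ r - b) * (z * σ z) + ((r * z) * σ δ + σ (r * z) * δ + δ * σ δ) := by
          have e2 : φ r = r * z + δ := by rw [hδ]; ring
          rw [e2, map_add, map_mul]
          linear_combination hbz
        rw [hN]
        have hv1 : Valued.v ((r * σ r - b) * (z * σ z)) ≤ Valued.v ϖ ^ (2 * e) := by
          rw [map_mul, hNz, mul_one]; exact hra
        have hv3 : Valued.v ((r * z) * σ δ + σ (r * z) * δ + δ * σ δ) ≤ Valued.v ϖ ^ (2 * e) := by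
          have hrz1 : Valued.v (r * z) ≤ 1 := by rw [map_mul, hr1, hz1, one_mul]
          refine (Valuation.map_add _ _ _).trans (max_le ((Valuation.map_add _ _ _).trans (max_le ?_ ?_)) ?_)
          · rw [map_mul, hvσ]; exact (mul_le_of_le_one_left' hrz1).trans hvδ'
          · rw [map_mul, hvσ]; exact (mul_le_of_le_one_left' hrz1).trans hvδ'
          · rw [map_mul, hvσ]
            exact (mul_le_of_le_one_right' (hvδ.trans (pow_le_one₀ zero_le hϖ1))).trans hvδ'
        exact (Valuation.map_add _ _ _).trans (max_le hv1 hv3)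
    · rw [Finset.mem_coe, Finset.mem_filter] at hr₁ hr₂
      have hz0 : z ≠ 0 := fun h0 => by rw [h0, map_zero] at hz1; exact zero_ne_one hz1
      refine hR₃ r₁ hr₁.1 r₂ hr₂.1 ?_
      have e3 : r₁ - r₂ = z⁻¹ * ((r₁ * z - φ r₁) - (r₂ * z - φ r₂)) := by rw [h]; field_simp; ring
      rw [e3, map_mul, map_inv₀, hz1, inv_one, one_mul]
      exact (Valuation.map_sub _ _ _).trans (max_le (hφ r₁ hr₁.1) (hφ r₂ hr₂.1))
  obtain ⟨z₀, hz₀⟩ := hz₀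
  have ha0 : a ≠ 0 := fun h => by rw [h, map_zero] at ha; exact zero_ne_one ha
  have ha'0 : a' ≠ 0 := fun h => by rw [h, map_zero] at ha'; exact zero_ne_one ha'
  have hz₀0 : z₀ ≠ 0 := fun h => by
    rw [h, zero_mul] at hz₀; exact div_ne_zero ha'0 ha0 hz₀.symm
  refine le_antisymm (key ha ha' ⟨z₀, hz₀⟩) (key ha' ha ⟨z₀⁻¹, ?_⟩)
  rw [map_inv₀, ← mul_inv, hz₀, inv_div]

/-! ## §2  (D⁻) The anisotropic vanishing at `j = 0` -/

omit [Valued K ℤᵐ⁰] in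
/-- The conic flip identity: `C₀ + C₁·(C₀∕C₁)²∕n = ((C₀∕C₁)∕n)·(C₀ + C₁n)` (exact algebra; `c = −C₀∕C₁`, `c² = (C₀∕C₁)²`, `−c = C₀∕C₁`). [cite: Serre1979, Ch. V §3] -/
theorem conic_flip_identity {C₀ C₁ n : K} (hC₁ : C₁ ≠ 0) (hn : n ≠ 0) :
    C₀ + C₁ * ((C₀ / C₁) ^ 2 / n) = (C₀ / C₁) / n * (C₀ + C₁ * n) := by
  field_simp
  ring

/-- **(D⁻) THE ANISOTROPIC VANISHING OF THE CONIC COUNT.**  Ramified datum on a complete `K` with finite residue field; `C₀, C₁` fixed units such that NEITHER `−C₀∕C₁` (anisotropy: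
the value `C₀ + C₁N r` never comes `ϖ^{2d−1}`-close to `0`) NOR `C₀∕C₁` (the flip sign) is a norm; `R` a complete irredundant residue system of `𝒪_K` modulo `ϖ^s` with `4d ≤ s + 3`.
Then **`Σ_{r ∈ R, |r| = 1} ω(C₀ + C₁·N r) = 0`** — the involution `r ↦ rep(c·(σ r)⁻¹)`, `c = −C₀∕C₁`, realises `n ↦ c²∕n` on the norms and `C₀ + C₁c²∕n = ((C₀∕C₁)∕n)·(C₀ + C₁n)`
flips `ω` (`ω(C₀∕C₁) = −1`, `ω(N r) = 1`). [cite: Serre1979, Ch. V §3 Cor. 3; Ch. XV §2] -/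
theorem sum_units_normSign_binaryNormForm_zero_eq_zero_of_not_isNorm [CompleteSpace K] [Finite 𝓀[K]] (hD : IsRamifiedQuadraticDatum σ ϖ d t)
    {C₀ C₁ : K} (hσC₀ : σ C₀ = C₀) (hC₀ : Valued.v C₀ = 1) (hσC₁ : σ C₁ = C₁) (hC₁ : Valued.v C₁ = 1)
    (hani : ¬ ∃ z : K, z * σ z = -(C₀ / C₁)) (hflip : ¬ ∃ z : K, z * σ z = C₀ / C₁)
    {s : ℕ} (hs : 4 * d ≤ s + 3)
    (R : Finset K) (_hR₁ : ∀ r ∈ R, Valued.v r ≤ 1) (hR₂ : ∀ x : K, Valued.v x ≤ 1 → ∃ r ∈ R, Valued.v (x - r) ≤ Valued.v ϖ ^ s)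
    (hR₃ : ∀ r ∈ R, ∀ r' ∈ R, Valued.v (r - r') ≤ Valued.v ϖ ^ s → r = r') :
    ∑ r ∈ R with Valued.v r = 1, normSign σ (C₀ + C₁ * (r * σ r)) = 0 := by
  classical
  obtain ⟨hσ, hvσ, hϖ, hfix, -, hd1, -⟩ := id hD
  have hϖ0' : Valued.v ϖ ≠ 0 := by rw [hϖ]; exact exp_ne_zero
  have hϖ1 : Valued.v ϖ ≤ 1 := by rw [hϖ, ← exp_zero]; exact exp_le_exp.2 (by norm_num)
  have hC₁0 : C₁ ≠ 0 := fun h => by rw [h, map_zero] at hC₁; exact zero_ne_one hC₁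
  have hC₀0 : C₀ ≠ 0 := fun h => by rw [h, map_zero] at hC₀; exact zero_ne_one hC₀
  have hq0 : C₀ / C₁ ≠ 0 := div_ne_zero hC₀0 hC₁0
  have hσq : σ (C₀ / C₁) = C₀ / C₁ := by rw [map_div₀, hσC₀, hσC₁]
  have hvq : Valued.v (C₀ / C₁) = 1 := by rw [map_div₀, hC₀, hC₁, div_one]
  set c : K := -(C₀ / C₁) with hc
  have hσc : σ c = c := by rw [hc, map_neg, hσq]
  have hvc : Valued.v c = 1 := by rw [hc, Valuation.map_neg, hvq]
  have hc0 : c ≠ 0 := neg_ne_zero.2 hq0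
  have hc2 : c ^ 2 = (C₀ / C₁) ^ 2 := by rw [hc, neg_sq]
  set Ru := R.filter (fun r => Valued.v r = 1) with hRu
  have hNσ : ∀ r : K, σ (r * σ r) = r * σ r := fun r => by rw [map_mul, hσ, mul_comm]
  have hN1 : ∀ r : K, Valued.v r = 1 → Valued.v (r * σ r) = 1 := fun r hr => by rw [map_mul, hvσ, hr, mul_one]
  have hy : ∀ r : K, C₀ + C₁ * (r * σ r) = C₁ * (r * σ r - c) := fun r => by rw [hc]; field_simp; ring
  have hσy : ∀ r : K, σ (C₀ + C₁ * (r * σ r)) = C₀ + C₁ * (r * σ r) := fun r => by rw [map_add, hσC₀, map_mul, hσC₁, hNσ]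
  -- ANISOTROPY: `|N r − c| ≥ |ϖ|^{2d−2}` for every unit `r`
  have hfar : ∀ r : K, Valued.v r = 1 → Valued.v ϖ ^ (2 * d - 2) ≤ Valued.v (r * σ r - c) := by
    intro r hr
    by_contra hlt
    rw [not_le] at hlt
    have hσw : σ (r * σ r - c) = r * σ r - c := by rw [map_sub, hNσ, hσc]
    have hle : Valued.v (r * σ r - c) ≤ Valued.v ϖ ^ (2 * d - 1) := by
      by_cases h0 : r * σ r - c = 0
      · rw [h0, map_zero]; exact zero_le
      · obtain ⟨n, hn⟩ := hfix _ hσw h0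
        rw [hn] at hlt ⊢
        rw [hϖ, ← exp_nsmul, nsmul_eq_mul] at hlt ⊢
        have h1 := exp_lt_exp.1 hlt
        exact exp_le_exp.2 (by omega)
    have hN0 : r * σ r ≠ 0 := fun h => by have := hN1 r hr; rw [h, map_zero] at this; exact zero_ne_one this
    have hσu : σ (c / (r * σ r)) = c / (r * σ r) := by rw [map_div₀, hσc, hNσ]
    have hr0 : r ≠ 0 := fun h => by rw [h, map_zero] at hr; exact zero_ne_one hr
    have hσr0 : σ r ≠ 0 := (map_ne_zero σ).2 hr0
    have hu1 : Valued.v (c / (r * σ r) - 1) ≤ Valued.v ϖ ^ (2 * d - 1) := by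
      have e1 : c / (r * σ r) - 1 = -((r * σ r - c) / (r * σ r)) := by field_simp; ring
      rw [e1, Valuation.map_neg, map_div₀, hN1 r hr, div_one]
      exact hle
    obtain ⟨z, hz⟩ := exists_mul_map_eq_of_fixed_of_v_sub_one_le_pred hD hσu le_rfl hu1
    refine hani ⟨z * r, ?_⟩
    rw [map_mul]
    calc z * r * (σ z * σ r) = (z * σ z) * (r * σ r) := by ring
      _ = c := by rw [hz, div_mul_cancel₀ _ hN0]
  have hy0 : ∀ r : K, Valued.v r = 1 → C₀ + C₁ * (r * σ r) ≠ 0 := fun r hr h => by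
    have h2 := hfar r hr
    rw [hy] at h
    rw [(mul_eq_zero.1 h).resolve_left hC₁0, map_zero, le_zero_iff] at h2
    exact pow_ne_zero _ hϖ0' h2
  -- the involution `Φ r := rep(c · (σ r)⁻¹)`
  have hrep : ∀ r ∈ Ru, ∃ r' ∈ R, Valued.v (c * (σ r)⁻¹ - r') ≤ Valued.v ϖ ^ s := fun r hr => by
    have hr1 := (Finset.mem_filter.1 hr).2
    exact hR₂ _ (by rw [map_mul, map_inv₀, hvσ, hvc, hr1, inv_one, mul_one])
  choose! Φ hΦR hΦ using hrep
  have hs1 : 1 ≤ s := by omega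
  have hsmall : Valued.v ϖ ^ s < 1 := by
    rw [hϖ, ← exp_nsmul, nsmul_eq_mul, mul_neg, mul_one, ← exp_zero]; exact exp_lt_exp.2 (by omega)
  have hΦ1 : ∀ r ∈ Ru, Valued.v (Φ r) = 1 := by
    intro r hr
    have hr1 := (Finset.mem_filter.1 hr).2
    have hx1 : Valued.v (c * (σ r)⁻¹) = 1 := by rw [map_mul, map_inv₀, hvσ, hvc, hr1, inv_one, mul_one]
    have hlt : Valued.v (Φ r - c * (σ r)⁻¹) < Valued.v (c * (σ r)⁻¹) := by
      rw [hx1, ← Valuation.map_neg, neg_sub]; exact lt_of_le_of_lt (hΦ r hr) hsmall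
    rw [show Φ r = c * (σ r)⁻¹ + (Φ r - c * (σ r)⁻¹) by ring, Valuation.map_add_eq_of_lt_left _ hlt, hx1]
  have hΦRu : ∀ r ∈ Ru, Φ r ∈ Ru := fun r hr => Finset.mem_filter.2 ⟨hΦR r hr, hΦ1 r hr⟩
  -- `N(Φ r)` is `ϖ^s`-close to `c² ∕ N r`
  have hNΦ : ∀ r ∈ Ru, Valued.v (Φ r * σ (Φ r) - c ^ 2 / (r * σ r)) ≤ Valued.v ϖ ^ s := by
    intro r hr
    have hr1 := (Finset.mem_filter.1 hr).2
    have hr0 : r ≠ 0 := fun h => by rw [h, map_zero] at hr1; exact zero_ne_one hr1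
    have hσr0 : σ r ≠ 0 := (map_ne_zero σ).2 hr0
    have hNx : (c * (σ r)⁻¹) * σ (c * (σ r)⁻¹) = c ^ 2 / (r * σ r) := by
      rw [map_mul, map_inv₀, hσ, hσc, div_eq_mul_inv, mul_inv, sq]; ring
    have hx1 : Valued.v (c * (σ r)⁻¹) ≤ 1 := by rw [map_mul, map_inv₀, hvσ, hvc, hr1, inv_one, mul_one]
    set x := c * (σ r)⁻¹ with hx
    set δ := Φ r - x with hδ
    have hvδ : Valued.v δ ≤ Valued.v ϖ ^ s := by rw [hδ, ← Valuation.map_neg, neg_sub]; exact hΦ r hr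
    have e2 : Φ r * σ (Φ r) - c ^ 2 / (r * σ r) = x * σ δ + σ x * δ + δ * σ δ := by
      rw [show Φ r = x + δ by rw [hδ]; ring, map_add, ← hNx]; ring
    rw [e2]
    refine (Valuation.map_add _ _ _).trans (max_le ((Valuation.map_add _ _ _).trans (max_le ?_ ?_)) ?_)
    · rw [map_mul, hvσ]; exact (mul_le_of_le_one_left' hx1).trans hvδ
    · rw [map_mul, hvσ]; exact (mul_le_of_le_one_left' hx1).trans hvδ
    · rw [map_mul, hvσ]; exact (mul_le_of_le_one_right' (hvδ.trans (pow_le_one₀ zero_le hϖ1))).trans hvδ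
  -- THE FLIP `ω(y(Φ r)) = −ω(y r)`
  have hflipr : ∀ r ∈ Ru, normSign σ (C₀ + C₁ * (Φ r * σ (Φ r))) = -normSign σ (C₀ + C₁ * (r * σ r)) := by
    intro r hr
    have hr1 := (Finset.mem_filter.1 hr).2
    have hN0 : r * σ r ≠ 0 := fun h => by have := hN1 r hr1; rw [h, map_zero] at this; exact zero_ne_one this
    -- the exact value `w := C₀ + C₁ c²∕N r = ((C₀∕C₁)∕N r) · y r`
    set w : K := C₀ + C₁ * (c ^ 2 / (r * σ r)) with hwdef
    have hwexact : w = (C₀ / C₁) / (r * σ r) * (C₀ + C₁ * (r * σ r)) := by rw [hwdef, hc2]; exact conic_flip_identity hC₁0 hN0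
    have hσw : σ w = w := by rw [hwdef, map_add, hσC₀, map_mul, hσC₁, map_div₀, map_pow, hσc, hNσ]
    have hw0 : w ≠ 0 := by rw [hwexact]; exact mul_ne_zero (div_ne_zero hq0 hN0) (hy0 r hr1)
    have hvw : Valued.v ϖ ^ (2 * d - 2) ≤ Valued.v w := by
      rw [hwexact, map_mul, map_div₀, hvq, hN1 r hr1, div_one, one_mul, hy, map_mul, hC₁, one_mul]
      exact hfar r hr1
    have hωw : normSign σ w = -normSign σ (C₀ + C₁ * (r * σ r)) := by
      rw [hwexact, normSign_mul_of_fixed hD (by rw [map_div₀, hσq, hNσ]) (hσy r) (div_ne_zero hq0 hN0) (hy0 r hr1),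
        show C₀ / C₁ / (r * σ r) = C₀ / C₁ * (r * σ r)⁻¹ by rw [div_eq_mul_inv],
        normSign_mul_of_fixed hD hσq (by rw [map_inv₀, hNσ]) hq0 (inv_ne_zero hN0), normSign_of_not_isNorm σ hflip]
      have hinv : normSign σ (r * σ r)⁻¹ = 1 := by
        refine normSign_of_isNorm σ ⟨r⁻¹, ?_⟩
        rw [map_inv₀, mul_inv]
      rw [hinv]; ring
    -- the actual value is `w · u` with `u ∈ U_F(2d−1)`
    have hdiff : C₀ + C₁ * (Φ r * σ (Φ r)) = w * (1 + C₁ * (Φ r * σ (Φ r) - c ^ 2 / (r * σ r)) / w) := by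
      rw [mul_add, mul_one, mul_div_cancel₀ _ hw0, hwdef]; ring
    have hσu : σ (1 + C₁ * (Φ r * σ (Φ r) - c ^ 2 / (r * σ r)) / w) = 1 + C₁ * (Φ r * σ (Φ r) - c ^ 2 / (r * σ r)) / w := by
      rw [map_add, map_one, map_div₀, map_mul, hσC₁, map_sub, hNσ, map_div₀, map_pow, hσc, hNσ, hσw]
    have hu : Valued.v (1 + C₁ * (Φ r * σ (Φ r) - c ^ 2 / (r * σ r)) / w - 1) ≤ Valued.v ϖ ^ (2 * d - 1) := by
      rw [add_sub_cancel_left, map_div₀, map_mul, hC₁, one_mul]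
      have hw' : 0 < Valued.v w := lt_of_lt_of_le (pow_pos (lt_of_le_of_ne zero_le hϖ0'.symm) _) hvw
      rw [div_le_iff₀ hw']
      calc Valued.v (Φ r * σ (Φ r) - c ^ 2 / (r * σ r)) ≤ Valued.v ϖ ^ s := hNΦ r hr
        _ ≤ Valued.v ϖ ^ (2 * d - 1 + (2 * d - 2)) := pow_le_pow_right_of_le_one' hϖ1 (by omega)
        _ = Valued.v ϖ ^ (2 * d - 1) * Valued.v ϖ ^ (2 * d - 2) := pow_add _ _ _
        _ ≤ Valued.v ϖ ^ (2 * d - 1) * Valued.v w := mul_le_mul' le_rfl hvw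
    rw [hdiff, normSign_mul_eq_of_fixed_of_v_sub_one_le hD w hσu le_rfl hu, hωw]
  -- `Φ` is injective on `Ru`, hence a bijection; summing the flip gives `Σ = −Σ`
  have hinj : ∀ r₁ ∈ Ru, ∀ r₂ ∈ Ru, Φ r₁ = Φ r₂ → r₁ = r₂ := by
    intro r₁ hr₁ r₂ hr₂ heq
    have h1 := (Finset.mem_filter.1 hr₁).2; have h2 := (Finset.mem_filter.1 hr₂).2
    have hr₁0 : σ r₁ ≠ 0 := (map_ne_zero σ).2 (fun h => by rw [h, map_zero] at h1; exact zero_ne_one h1)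
    have hr₂0 : σ r₂ ≠ 0 := (map_ne_zero σ).2 (fun h => by rw [h, map_zero] at h2; exact zero_ne_one h2)
    refine hR₃ r₁ (Finset.mem_filter.1 hr₁).1 r₂ (Finset.mem_filter.1 hr₂).1 ?_
    have hdlt : Valued.v (c * (σ r₁)⁻¹ - c * (σ r₂)⁻¹) ≤ Valued.v ϖ ^ s := by
      rw [show c * (σ r₁)⁻¹ - c * (σ r₂)⁻¹ = (c * (σ r₁)⁻¹ - Φ r₁) - (c * (σ r₂)⁻¹ - Φ r₂) by rw [heq]; ring]
      exact (Valuation.map_sub _ _ _).trans (max_le (hΦ r₁ hr₁) (hΦ r₂ hr₂))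
    have e : c * (σ r₁)⁻¹ - c * (σ r₂)⁻¹ = c * σ (r₂ - r₁) * ((σ r₁)⁻¹ * (σ r₂)⁻¹) := by
      rw [map_sub]; field_simp
    rw [e, map_mul, map_mul, hvc, one_mul, hvσ, map_mul, map_inv₀, map_inv₀, hvσ, hvσ, h1, h2, inv_one, mul_one, mul_one,
      Valuation.map_sub_swap] at hdlt
    exact hdlt
  have hsum : ∑ r ∈ Ru, normSign σ (C₀ + C₁ * (Φ r * σ (Φ r))) = ∑ r ∈ Ru, normSign σ (C₀ + C₁ * (r * σ r)) :=
    Finset.sum_bij (fun r _ => Φ r) (fun r hr => hΦRu r hr) (fun r₁ hr₁ r₂ hr₂ h => hinj r₁ hr₁ r₂ hr₂ h)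
      (fun r' hr' => by
        have himg : Ru.image Φ = Ru := Finset.eq_of_subset_of_card_le (Finset.image_subset_iff.2 fun r hr => hΦRu r hr)
          (by rw [Finset.card_image_of_injOn (fun r₁ hr₁ r₂ hr₂ h => hinj r₁ hr₁ r₂ hr₂ h)])
        have hr'' : r' ∈ Ru.image Φ := by rw [himg]; exact hr'
        obtain ⟨r, hr, hrr'⟩ := Finset.mem_image.1 hr''
        exact ⟨r, hr, hrr'⟩)
      (fun _ _ => rfl)
  have hneg : ∑ r ∈ Ru, normSign σ (C₀ + C₁ * (Φ r * σ (Φ r))) = -∑ r ∈ Ru, normSign σ (C₀ + C₁ * (r * σ r)) := by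
    rw [← Finset.sum_neg_distrib]; exact Finset.sum_congr rfl hflipr
  have h2 : (2 : ℤ) * ∑ r ∈ Ru, normSign σ (C₀ + C₁ * (r * σ r)) = 0 := by linarith
  simpa using h2

end Summit.HodgeConjecture.HodgeConjecture.Cruxes.H413.F0P3cDyRamBinaryNormFormConicCount

end
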